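import Mathlib
import HarnessLib
import HarnessLib.Audit
import Summits.ValiantsHypothesis.ValiantsHypothesis.Theorems.LacunarySymmetroidMatrixDescartesMonomialRow

/-!
# ValiantsHypothesis / LacunarySymmetroid — crux `MatrixDescartes` (stmt-ValiantsHypothesis-18050, V1), LINE (A) «product_plus_one»:
# the middle-binomial cell `MiddleBinomialBlockAtMostOne` (pen val-idea-25 g9 NOTE §56.11; Sketch-T3-s59 rev 2/3)

The pen's Sketch `abprobe/s59/card/Sketch-T3-s59.lean` (rev 3, 0921fc69ea2b4f88) types `MiddleBinomialBlockAtMostOne` (THEOREM 56.11,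
middle-binomial cell, «exact, proved on paper»): one W row `(−α, κ, γ)` and any `k` MIDDLE-binomial zero-change rows `p_i + q_iX^a`
have at most ONE positive critical point.  Proved here VERBATIM (`middleBinomialBlockAtMostOne`) in the `t`-picture: at a critical
point `t` off the roots the logarithmic derivative vanishes, `a·M(t) + c·T(t) = 0` (`critical_relation`), and here the only top letter
is the W row's, so `T = γt^c/g_W < 0` and hence `M > 0`; the concavity criterion (`concavityCriterion_of_nonneg`, module `…BinomialLead`
— the Sketch's `concavityCriterion` carries the side condition `a₂ ≠ 0`, false for these rows) makes every positive critical point a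
strict local maximum of `|Φ|`, and `card_posRoots_le_one_of_deriv_pos` (module `…MonomialRow`) concludes.

HONEST FRAMING: exact free-standing helper; NOT `TopBinomialBlockAtMostTwo` / T3♯ / T3♮ / P6 / the floor law; no stub of LINE (A) is
touched (A40 unchanged, sorries 4 → 4); `MatrixDescartes` OPEN; `VP ≠ VNP` is NOT proved and nothing here bears on it.
-/

set_option linter.dupNamespace false

namespace Summit.ValiantsHypothesis.ValiantsHypothesis.Theorems.LacunarySymmetroidMatrixDescartes

namespace ZeroChange

open Polynomial Finset

/-- **Logarithmic derivative of a row product**: where no row vanishes, `Φ′(x) = Φ(x)·Σ_j g_j′(x)/g_j(x)`. -/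
theorem eval_derivative_prod_rows (m a c : ℕ) (co : Fin m → ℝ × ℝ × ℝ) {x : ℝ}
    (hx : ∀ j, (row a c (co j).1 (co j).2.1 (co j).2.2).eval x ≠ 0) :
    (derivative (∏ j, row a c (co j).1 (co j).2.1 (co j).2.2)).eval x =
      (∏ j, row a c (co j).1 (co j).2.1 (co j).2.2).eval x *
        ∑ j, (derivative (row a c (co j).1 (co j).2.1 (co j).2.2)).eval x / (row a c (co j).1 (co j).2.1 (co j).2.2).eval x := by
  classical
  rw [derivative_prod_finset, eval_finsetSum, eval_prod, mul_sum]
  refine sum_congr rfl fun j _ => ?_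
  rw [eval_mul, eval_prod, ← mul_prod_erase univ (fun i => (row a c (co i).1 (co i).2.1 (co i).2.2).eval x) (mem_univ j)]
  field_simp [hx j]

/-- **Critical relation** (Euler operator form): at a positive critical point `t` of `Φ = ∏ g_j` off the roots,
`a·M(t) + c·T(t) = 0`, where `M = Σ_j a₁ⱼt^a/g_j` is `middleSum` and `T = Σ_j a₂ⱼt^c/g_j` the top-letter Pick sum. -/
theorem critical_relation (m a c : ℕ) (co : Fin m → ℝ × ℝ × ℝ) {t : ℝ}
    (hΦ : (∏ j, row a c (co j).1 (co j).2.1 (co j).2.2).eval t ≠ 0)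
    (hcrit : (derivative (∏ j, row a c (co j).1 (co j).2.1 (co j).2.2)).eval t = 0) :
    (a : ℝ) * middleSum a c co t + (c : ℝ) * ∑ j, (co j).2.2 * t ^ c / (row a c (co j).1 (co j).2.1 (co j).2.2).eval t = 0 := by
  classical
  have hgt : ∀ j, (row a c (co j).1 (co j).2.1 (co j).2.2).eval t ≠ 0 := by
    intro j h0
    apply hΦ
    rw [eval_prod]
    exact prod_eq_zero (mem_univ j) h0
  have hS : ∑ j, (derivative (row a c (co j).1 (co j).2.1 (co j).2.2)).eval t / (row a c (co j).1 (co j).2.1 (co j).2.2).eval t = 0 := by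
    have := eval_derivative_prod_rows m a c co hgt
    rw [hcrit] at this
    exact (mul_eq_zero.1 this.symm).resolve_left hΦ
  have e : (a : ℝ) * middleSum a c co t + (c : ℝ) * ∑ j, (co j).2.2 * t ^ c / (row a c (co j).1 (co j).2.1 (co j).2.2).eval t =
      t * ∑ j, (derivative (row a c (co j).1 (co j).2.1 (co j).2.2)).eval t / (row a c (co j).1 (co j).2.1 (co j).2.2).eval t := by
    rw [middleSum, mul_sum, mul_sum, mul_sum, ← sum_add_distrib]
    refine sum_congr rfl fun j _ => ?_
    have hP := mul_eval_derivative_row a c (co j).1 (co j).2.1 (co j).2.2 t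
    rw [show t * ((derivative (row a c (co j).1 (co j).2.1 (co j).2.2)).eval t / (row a c (co j).1 (co j).2.1 (co j).2.2).eval t) =
      (t * (derivative (row a c (co j).1 (co j).2.1 (co j).2.2)).eval t) / (row a c (co j).1 (co j).2.1 (co j).2.2).eval t by ring, hP]
    ring
  rw [e, hS, mul_zero]

/-- **MIDDLE-BINOMIAL CELL (NOTE §56.11) — the pen g9 Sketch-T3-s59 `MiddleBinomialBlockAtMostOne`, VERBATIM**: one W row
`(−α, κ, γ)` and any `k` middle-binomial zero-change rows `p_i + q_iX^a` have at most ONE positive critical point. -/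
theorem middleBinomialBlockAtMostOne : ∀ (k a c : ℕ), 0 < a → a < c → ∀ (α κ γ : ℝ) (p q : Fin k → ℝ),
    0 < α → 0 ≤ κ → 0 < γ → (∀ i, 0 < p i ∧ 0 < q i) →
    posCrit (row a c (-α) κ γ * ∏ i, row a c (p i) (q i) 0) ≤ 1 := by
  intro k a c ha hac α κ γ p q hα hκ hγ h
  classical
  have hc : 0 < c := ha.trans hac
  set co : Fin (k + 1) → ℝ × ℝ × ℝ := Fin.cons ((-α, κ, γ) : ℝ × ℝ × ℝ) (fun i => (p i, q i, 0)) with hco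
  set Φ : ℝ[X] := row a c (-α) κ γ * ∏ i, row a c (p i) (q i) 0 with hΦ
  have hΦco : Φ = ∏ j, row a c (co j).1 (co j).2.1 (co j).2.2 := by
    rw [hΦ, Fin.prod_univ_succ]
    simp [hco]
  -- the block
  set B : ℝ[X] := ∏ i, row a c (p i) (q i) 0 with hB
  have hBpos : ∀ t, 0 < t → 0 < B.eval t := by
    intro t ht
    rw [hB, eval_prod]
    exact prod_pos fun i _ => eval_row_pos' (h i).1 (h i).2.le le_rfl ht
  have hBcoef : ∀ n, 0 ≤ B.coeff n :=
    coeff_nonneg_prod _ _ (fun i _ n => coeff_row_nonneg (h i).1.le (h i).2.le le_rfl n)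
  have hB'nn : ∀ t, 0 < t → 0 ≤ (derivative B).eval t := by
    intro t ht
    rw [eval_eq_sum_range]
    exact sum_nonneg fun i _ => mul_nonneg (by rw [coeff_derivative]; exact mul_nonneg (hBcoef _) (by positivity))
      (pow_nonneg ht.le i)
  have hW' : ∀ t, t * (derivative (row a c (-α) κ γ)).eval t = (a : ℝ) * κ * t ^ a + (c : ℝ) * γ * t ^ c :=
    fun t => mul_eval_derivative_row a c _ _ _ t
  -- every positive critical point has g_W < 0
  have hcrit_neg : ∀ t, 0 < t → (derivative Φ).eval t = 0 → (row a c (-α) κ γ).eval t < 0 := by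
    intro t ht hd
    by_contra hge
    push Not at hge
    have hd' : (derivative Φ).eval t = (derivative (row a c (-α) κ γ)).eval t * B.eval t +
        (row a c (-α) κ γ).eval t * (derivative B).eval t := by
      rw [hΦ, derivative_mul, eval_add, eval_mul, eval_mul]
    have hgW' : 0 < (derivative (row a c (-α) κ γ)).eval t := by
      have e := hW' t
      have hc' : (0 : ℝ) < c := by exact_mod_cast hc
      have h2 : 0 < (a : ℝ) * κ * t ^ a + (c : ℝ) * γ * t ^ c :=
        add_pos_of_nonneg_of_pos (by positivity) (mul_pos (mul_pos hc' hγ) (pow_pos ht c))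
      nlinarith
    have : 0 < (derivative Φ).eval t := by
      rw [hd']
      nlinarith [mul_pos hgW' (hBpos t ht), mul_nonneg hge (hB'nn t ht)]
    linarith
  -- Φ'' > 0 at every positive critical point
  have hmax : ∀ t, 0 < t → (derivative Φ).eval t = 0 → 0 < (derivative (derivative Φ)).eval t := by
    intro t ht hd
    have hgW := hcrit_neg t ht hd
    have hΦt : Φ.eval t < 0 := by
      rw [hΦ, eval_mul]; exact mul_neg_of_neg_of_pos hgW (hBpos t ht)
    have hΦne : (∏ j, row a c (co j).1 (co j).2.1 (co j).2.2).eval t ≠ 0 := by rw [← hΦco]; exact hΦt.ne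
    have hd' : (derivative (∏ j, row a c (co j).1 (co j).2.1 (co j).2.2)).eval t = 0 := by rw [← hΦco]; exact hd
    -- M > 0 from the critical relation: the only top letter is the W row's
    have hrel := critical_relation (k + 1) a c co hΦne hd'
    have hT : ∑ j : Fin (k + 1), (co j).2.2 * t ^ c / (row a c (co j).1 (co j).2.1 (co j).2.2).eval t =
        γ * t ^ c / (row a c (-α) κ γ).eval t := by
      rw [Fin.sum_univ_succ]
      simp [hco]
    rw [hT] at hrel
    have hTneg : γ * t ^ c / (row a c (-α) κ γ).eval t < 0 :=
      div_neg_of_pos_of_neg (mul_pos hγ (pow_pos ht c)) hgW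
    have hc' : (0 : ℝ) < c := by exact_mod_cast hc
    have ha' : (0 : ℝ) < a := by exact_mod_cast ha
    have hM : 0 < middleSum a c co t := by nlinarith [mul_neg_of_pos_of_neg hc' hTneg]
    have hj : ∃ j, t * (derivative (row a c (co j).1 (co j).2.1 (co j).2.2)).eval t ≠ 0 := by
      refine ⟨0, ?_⟩
      simp only [hco, Fin.cons_zero]
      rw [hW' t]
      have : 0 < (a : ℝ) * κ * t ^ a + (c : ℝ) * γ * t ^ c :=
        add_pos_of_nonneg_of_pos (by positivity) (mul_pos (mul_pos hc' hγ) (pow_pos ht c))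
      exact this.ne'
    have hcc := concavityCriterion_of_nonneg (k + 1) a c ha hac co ht hΦne hd' hM.le hj
    rw [← hΦco] at hcc
    nlinarith
  rw [posCrit]
  exact card_posRoots_le_one_of_deriv_pos _ hmax

end ZeroChange

end Summit.ValiantsHypothesis.ValiantsHypothesis.Theorems.LacunarySymmetroidMatrixDescartes
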